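import Summits.CriticalPhenomena.SAWScalingLimit.Theses.SAWTwistedSelfEnergy

/-!
# `TwistedGapEquation` (stmt-CriticalPhenomena-17874) and `TwistedKernelLowOrder` (stmt-17876) are FALSE as typed:
# the `n = 0` slice of the kernel is free

Planner skeleton-registrar finding, 2026-08-17 (sorry-free; axioms `propext`, `Classical.choice`, `Quot.sound`).

The shared `let IsTwistedKernel K` block of route `SAWTwistedSelfEnergy` constrains `K m` only for
`m ∈ Finset.Icc 1 n` (recursion clause) and kills `K n z` only off `box 2 n` (support clause); since
`box 2 0 = {0}`, the matrix `K 0 0 : Matrix (Fin 4) (Fin 4) ℂ` is UNCONSTRAINED.  The crux sums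
`n ∈ Finset.range (N + 1)`, i.e. it includes the free `n = 0` term `∑ k, K 0 0 0 k * I ^ k`.

* `crux_iff` (`Iff.rfl`): the route decl, unfolded, over the named vocabulary of this file;
* `isTwistedKernel_bump`, `partialSum_bump`: bumping `K 0 0` by the matrix unit `E₀₀` keeps `IsTwistedKernel`
  and shifts EVERY partial sum of the crux by `1`;
* `not_crux_of_kernel`, `crux_iff_no_kernel`: hence `TwistedGapEquation ↔ (∀ K, ¬ IsTwistedKernel K)`;
* `kstar`, `kstar_isTwistedKernel`: a twisted kernel EXISTS — the `n ≥ 1` system is triangular (the `m = n` term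
  of the recursion is `K n z` because `G 0 = δ₀ · 1`), solved level by level with `K⋆ 0 = 0`; the recursion is
  verified for all `n ≥ 1` and ALL `z` (off the box every term vanishes: `G n`, the `T`-term and the convolution
  are supported in `box 2 n`, by `SAW.Zd.abs_apply_le_of_adj`);
* `twistedGapEquation_false : ¬ TwistedGapEquation`, `twistedKernelLowOrder_false : ¬ TwistedKernelLowOrder`
  (the support item asks `K 0 z = 0`, which the bump violates).

CLASS: misstated.  REPAIR (R1, recommended; restores "the recursion determines K uniquely"): prepend `K 0 = 0 ∧`
to the `IsTwistedKernel` let of both items (`K⋆` then is THE kernel: `kstar_isTwistedKernel_repaired`);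
(R2, minimal): sum from `n = 1` (`∑ n ∈ Finset.Icc 1 N`) in 17874 and ask `1 ≤ n → n ≤ 3 →` in 17876.
Repaired signature strings (elaboration-checked): `repair/*.sig` in the registrar's folder, quoted in `MISSTATED.md`.
`TwistedKernelSummable` / `TwistedKernelTailIndex` are insensitive to the free slice (finite perturbation);
`DomainTransfer` and `Assembly` take `TwistedGapEquation` as a HYPOTHESIS and are therefore VACUOUSLY provable
until the restate — restate first.
-/

noncomputable section

open Filter Topology
open scoped BigOperators Topology Classical Matrix
open Literature.Probability.RandomPlanarGeometry Literature.Probability.LatticeModels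

namespace Summit.CriticalPhenomena.SAWScalingLimit.Cruxes.TwistedGapEquation.Misstatement

/-! ### Vocabulary: the route's shared `let` block, letter for letter -/

/-- the four lattice directions `E, N, W, S` (the route's `let dir`) -/
def dir : Fin 4 → Site 2 := ![![1, 0], ![0, 1], ![-1, 0], ![0, -1]]

/-- the spin `σ = 5/8` (the route's `let σ`) -/
def spin : ℝ := 5 / 8

/-- the one-step twisted non-backtracking matrix `T` (the route's `let T`) -/
def stepMatrix : Matrix (Fin 4) (Fin 4) ℂ := fun a b =>
  if dir b = -dir a then 0 else
    Complex.exp (-Complex.I * spin *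
      (turning (-Site.toComplex (dir a)) 0 (Site.toComplex (dir b)) : ℝ))

/-- the twisted two-point matrices `G n z` (the route's `let G`) -/
def twoPoint : ℕ → Site 2 → Matrix (Fin 4) (Fin 4) ℂ := fun n z ι κ =>
  if n = 0 then (if z = 0 ∧ ι = κ then 1 else 0) else
    ∑ p ∈ ((zdGraph 2).finsetWalkLength n (0 : Site 2) z).filter (fun p => p.IsPath),
      (if p.getVert 1 = -dir ι ∨ z - p.getVert (n - 1) ≠ dir κ then 0 else
        Complex.exp (-Complex.I * spin *
          (winding ((-Site.toComplex (dir ι)) :: (p.support.map Site.toComplex)) : ℝ)))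

/-- the route's `let IsTwistedKernel` -/
def IsTwistedKernel (K : ℕ → Site 2 → Matrix (Fin 4) (Fin 4) ℂ) : Prop :=
  (∀ n z, z ∉ box 2 n → K n z = 0) ∧
  (∀ n, 1 ≤ n → ∀ z, twoPoint n z =
    Matrix.of (fun ι κ => ∑ κ' : Fin 4, twoPoint (n - 1) (z - dir κ) ι κ' * stepMatrix κ' κ) +
      ∑ m ∈ Finset.Icc 1 n, ∑ y ∈ box 2 m, K m y * twoPoint (n - m) (z - y))

/-- the spin-sector partial sums of the crux -/
def partialSum (K : ℕ → Site 2 → Matrix (Fin 4) (Fin 4) ℂ) (N : ℕ) : ℂ :=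
  ∑ n ∈ Finset.range (N + 1), (SAW.criticalFugacity : ℂ) ^ n *
    ∑ z ∈ box 2 n, ∑ k : Fin 4, K n z 0 k * Complex.I ^ (k : ℕ)

/-- the gap-equation value `1 - x_c (1 + 2 cos (3π/16))` -/
def gapValue : ℂ :=
  1 - (SAW.criticalFugacity : ℂ) * ((1 + 2 * Real.cos (3 * Real.pi / 16) : ℝ) : ℂ)

/-- Sanity (definitional): the route's crux is the statement over this vocabulary. -/
theorem crux_iff :
    Summit.CriticalPhenomena.SAWScalingLimit.Theses.SAWTwistedSelfEnergy.TwistedGapEquation ↔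
      ∀ K, IsTwistedKernel K → Tendsto (partialSum K) atTop (𝓝 gapValue) :=
  Iff.rfl

/-- Sanity (definitional): the route's support item `TwistedKernelLowOrder` over this vocabulary. -/
theorem lowOrder_iff :
    Summit.CriticalPhenomena.SAWScalingLimit.Theses.SAWTwistedSelfEnergy.TwistedKernelLowOrder ↔
      ∀ K, IsTwistedKernel K → (∀ n, n ≤ 3 → ∀ z, K n z = 0) ∧ (∀ z, z ≠ 0 → K 4 z = 0) ∧
        Matrix.trace (K 4 0) = ((4 * Real.sqrt 2 : ℝ) : ℂ) :=
  Iff.rfl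

/-! ### The free `n = 0` slice -/

/-- the matrix unit `E₀₀` -/
def unit00 : Matrix (Fin 4) (Fin 4) ℂ := Matrix.of fun i j => if i = 0 ∧ j = 0 then 1 else 0

/-- bump a kernel at `(n, z) = (0, 0)` by `E₀₀` -/
def bump (K : ℕ → Site 2 → Matrix (Fin 4) (Fin 4) ℂ) : ℕ → Site 2 → Matrix (Fin 4) (Fin 4) ℂ :=
  fun n z => if n = 0 ∧ z = 0 then K n z + unit00 else K n z

theorem zero_mem_box (n : ℕ) : (0 : Site 2) ∈ box 2 n := by
  simp [mem_box]

theorem box_two_zero : box 2 0 = {0} := by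
  rw [box_eq_Icc, Nat.cast_zero, neg_zero, Finset.Icc_self]

/-- Bumping preserves `IsTwistedKernel`: the recursion clause only sees `K m`, `m ≥ 1`. -/
theorem isTwistedKernel_bump {K : ℕ → Site 2 → Matrix (Fin 4) (Fin 4) ℂ}
    (hK : IsTwistedKernel K) : IsTwistedKernel (bump K) := by
  refine ⟨fun n z hz => ?_, fun n hn z => ?_⟩
  · unfold bump
    split_ifs with h0
    · exact absurd (h0.2 ▸ zero_mem_box n) hz
    · exact hK.1 n z hz
  · rw [hK.2 n hn z]
    congr 1
    refine Finset.sum_congr rfl fun m hm => Finset.sum_congr rfl fun y _ => ?_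
    have hm1 : m ≠ 0 := by
      have := (Finset.mem_Icc.1 hm).1
      omega
    simp [bump, hm1]

/-- Bumping shifts every partial sum of the crux by exactly `1`. -/
theorem partialSum_bump (K : ℕ → Site 2 → Matrix (Fin 4) (Fin 4) ℂ) (N : ℕ) :
    partialSum (bump K) N = partialSum K N + 1 := by
  unfold partialSum
  rw [Finset.sum_range_succ' _ N, Finset.sum_range_succ' (fun n => (SAW.criticalFugacity : ℂ) ^ n *
    ∑ z ∈ box 2 n, ∑ k : Fin 4, K n z 0 k * Complex.I ^ (k : ℕ)) N]
  have h1 : ∀ i z, bump K (i + 1) z = K (i + 1) z := fun i z => by simp [bump]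
  simp only [h1, box_two_zero, Finset.sum_singleton, pow_zero, one_mul]
  have h0 : bump K 0 0 = K 0 0 + unit00 := by simp [bump]
  rw [h0]
  simp [Fin.sum_univ_four, unit00, Matrix.add_apply]
  ring

/-- **The defect.** If ANY twisted kernel exists, the crux as typed is false. -/
theorem not_crux_of_kernel (K : ℕ → Site 2 → Matrix (Fin 4) (Fin 4) ℂ) (hK : IsTwistedKernel K) :
    ¬ Summit.CriticalPhenomena.SAWScalingLimit.Theses.SAWTwistedSelfEnergy.TwistedGapEquation := by
  intro h
  rw [crux_iff] at h
  have h1 : Tendsto (fun N => partialSum K N + 1) atTop (𝓝 (gapValue + 1)) := (h K hK).add_const 1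
  have h2 : Tendsto (fun N => partialSum K N + 1) atTop (𝓝 gapValue) :=
    (h (bump K) (isTwistedKernel_bump hK)).congr (partialSum_bump K)
  have := tendsto_nhds_unique h2 h1
  have : (1 : ℂ) = 0 := by linear_combination -this
  exact one_ne_zero this

/-- Equivalently: the crux as typed says "no twisted kernel exists". -/
theorem crux_iff_no_kernel :
    Summit.CriticalPhenomena.SAWScalingLimit.Theses.SAWTwistedSelfEnergy.TwistedGapEquation ↔
      ∀ K, ¬ IsTwistedKernel K :=
  ⟨fun h K hK => not_crux_of_kernel K hK h, fun h => (crux_iff).2 fun K hK => absurd hK (h K)⟩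

/-- The same free slice sinks the support item `TwistedKernelLowOrder` (it asks `K 0 z = 0`). -/
theorem not_lowOrder_of_kernel (K : ℕ → Site 2 → Matrix (Fin 4) (Fin 4) ℂ) (hK : IsTwistedKernel K) :
    ¬ Summit.CriticalPhenomena.SAWScalingLimit.Theses.SAWTwistedSelfEnergy.TwistedKernelLowOrder := by
  intro h
  rw [lowOrder_iff] at h
  have h1 : K 0 0 = 0 := (h K hK).1 0 (by norm_num) 0
  have h2 : bump K 0 0 = 0 := (h (bump K) (isTwistedKernel_bump hK)).1 0 (by norm_num) 0
  have h3 : bump K 0 0 = K 0 0 + unit00 := by simp [bump]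
  rw [h3, h1, zero_add] at h2
  have : unit00 0 0 = 0 := by rw [h2]; rfl
  simp [unit00] at this

/-! ### A twisted kernel EXISTS (the `n ≥ 1` system is triangular), so both items are FALSE as typed -/

/-- the `T`-term of the recursion at level `n` (the `Matrix.of …` summand of `IsTwistedKernel`) -/
def tTerm (n : ℕ) (z : Site 2) : Matrix (Fin 4) (Fin 4) ℂ :=
  Matrix.of fun ι κ => ∑ κ' : Fin 4, twoPoint (n - 1) (z - dir κ) ι κ' * stepMatrix κ' κ

/-- approximants of the canonical kernel: `kApprox N m` is the kernel at the levels `m ≤ N` (and `0` above),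
built level by level by solving the triangular recursion -/
def kApprox : ℕ → ℕ → Site 2 → Matrix (Fin 4) (Fin 4) ℂ
  | 0 => fun _ _ => 0
  | N + 1 => fun m z =>
      if m ≤ N then kApprox N m z
      else if m = N + 1 then
        (if z ∈ box 2 (N + 1) then
          twoPoint (N + 1) z - tTerm (N + 1) z -
            ∑ j ∈ Finset.Icc 1 N, ∑ y ∈ box 2 j, kApprox N j y * twoPoint (N + 1 - j) (z - y)
        else 0)
      else 0

/-- **the canonical twisted kernel** `K⋆`: `K⋆ 0 = 0`, and for `n ≥ 1`, `z ∈ box 2 n`,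
`K⋆ n z = G n z − (T-term) − Σ_{1 ≤ m < n} Σ_y K⋆ m y · G (n−m) (z−y)` (the `m = n` term of the recursion
isolates `K n z` because `G 0 = δ_0 · 1`) -/
def kstar (n : ℕ) : Site 2 → Matrix (Fin 4) (Fin 4) ℂ := kApprox n n

theorem kApprox_of_le {N m : ℕ} (h : m ≤ N) : kApprox N m = kstar m := by
  induction N with
  | zero =>
    obtain rfl : m = 0 := Nat.le_zero.1 h
    rfl
  | succ N ih =>
    rcases Nat.lt_or_eq_of_le h with h' | rfl
    · have hle : m ≤ N := Nat.lt_succ_iff.1 h'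
      funext z
      rw [← ih hle]
      simp only [kApprox, if_pos hle]
    · rfl

theorem kstar_zero : kstar 0 = 0 := rfl

theorem kstar_succ (N : ℕ) (z : Site 2) :
    kstar (N + 1) z = if z ∈ box 2 (N + 1) then twoPoint (N + 1) z - tTerm (N + 1) z -
      ∑ j ∈ Finset.Icc 1 N, ∑ y ∈ box 2 j, kstar j y * twoPoint (N + 1 - j) (z - y) else 0 := by
  have h1 : ¬ (N + 1 ≤ N) := Nat.not_succ_le_self N
  show kApprox (N + 1) (N + 1) z = _
  simp only [kApprox, if_neg h1, if_true]
  split_ifs with hz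
  · congr 1
    refine Finset.sum_congr rfl fun j hj => Finset.sum_congr rfl fun y _ => ?_
    rw [kApprox_of_le (Finset.mem_Icc.1 hj).2]
  · rfl

theorem kstar_eq_zero_of_not_mem {n : ℕ} {z : Site 2} (hz : z ∉ box 2 n) : kstar n z = 0 := by
  cases n with
  | zero => rfl
  | succ N => rw [kstar_succ, if_neg hz]

theorem twoPoint_zero_apply (w : Site 2) (ι κ : Fin 4) :
    twoPoint 0 w ι κ = if w = 0 ∧ ι = κ then 1 else 0 := by
  dsimp only [twoPoint]
  rw [if_pos rfl]

theorem sum_mul_twoPoint_zero (f : Site 2 → Matrix (Fin 4) (Fin 4) ℂ) (s : Finset (Site 2)) (z : Site 2) :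
    ∑ y ∈ s, f y * twoPoint 0 (z - y) = if z ∈ s then f z else 0 := by
  have h : ∀ y, twoPoint 0 (z - y) = if z = y then 1 else 0 := by
    intro y
    ext ι κ
    rw [twoPoint_zero_apply]
    by_cases hzy : z = y
    · subst hzy
      simp [Matrix.one_apply]
    · have hne : z - y ≠ 0 := sub_ne_zero.2 hzy
      simp [hne, hzy]
  simp_rw [h, mul_ite, mul_one, mul_zero]
  exact Finset.sum_ite_eq s z f

/-- an `n`-step lattice walk from `0` ends in `box 2 n` -/
theorem mem_box_of_walk {z : Site 2} (p : (zdGraph 2).Walk (0 : Site 2) z) : z ∈ box 2 p.length := by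
  have h : ∀ j, |p.getVert p.length j| ≤ ((p.length : ℕ) : ℤ) :=
    SAW.Zd.abs_apply_le_of_adj (d := 2) (ω := fun i => p.getVert i) (n := p.length)
      p.getVert_zero (fun i hi => p.adj_getVert_succ hi) p.length le_rfl
  rw [p.getVert_length] at h
  rw [mem_box]
  intro i
  exact abs_le.1 (h i)

/-- `G n` is supported in `box 2 n` -/
theorem twoPoint_eq_zero_of_not_mem {n : ℕ} {z : Site 2} (hz : z ∉ box 2 n) : twoPoint n z = 0 := by
  cases n with
  | zero =>
    ext ι κ
    rw [twoPoint_zero_apply, Matrix.zero_apply, if_neg]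
    rintro ⟨rfl, -⟩
    exact hz (zero_mem_box 0)
  | succ N =>
    ext ι κ
    dsimp only [twoPoint]
    rw [if_neg (Nat.succ_ne_zero N), Matrix.zero_apply]
    apply Finset.sum_eq_zero
    intro p hp
    exfalso
    have hlen : p.length = N + 1 := SimpleGraph.mem_finsetWalkLength_iff.1 (Finset.mem_filter.1 hp).1
    exact hz (hlen ▸ mem_box_of_walk p)

theorem dir_mem_box_one (κ : Fin 4) : dir κ ∈ box 2 1 := by
  fin_cases κ <;> simp [dir, mem_box, Fin.forall_fin_two]

theorem add_mem_box {m k : ℕ} {a b : Site 2} (ha : a ∈ box 2 m) (hb : b ∈ box 2 k) :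
    a + b ∈ box 2 (m + k) := by
  rw [mem_box] at ha hb ⊢
  intro i
  obtain ⟨h1, h2⟩ := ha i
  obtain ⟨h3, h4⟩ := hb i
  simp only [Pi.add_apply, Nat.cast_add]
  constructor <;> linarith

/-- the `T`-term is supported in `box 2 n` as well -/
theorem tTerm_eq_zero_of_not_mem {N : ℕ} {z : Site 2} (hz : z ∉ box 2 (N + 1)) : tTerm (N + 1) z = 0 := by
  ext ι κ
  simp only [tTerm, Matrix.of_apply, Matrix.zero_apply, Nat.add_sub_cancel]
  apply Finset.sum_eq_zero
  intro κ' _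
  have h : z - dir κ ∉ box 2 N := fun h => hz (by simpa using add_mem_box h (dir_mem_box_one κ))
  rw [twoPoint_eq_zero_of_not_mem h, Matrix.zero_apply, zero_mul]

/-- **`K⋆` is a twisted kernel in the sense of the route** (support clause + the square recursion for all
`n ≥ 1` and ALL `z`, on and off the box). -/
theorem kstar_isTwistedKernel : IsTwistedKernel kstar := by
  refine ⟨fun n z hz => kstar_eq_zero_of_not_mem hz, fun n hn z => ?_⟩
  obtain ⟨N, rfl⟩ : ∃ N, n = N + 1 := ⟨n - 1, by omega⟩
  have ht : (Matrix.of fun ι κ => ∑ κ' : Fin 4, twoPoint (N + 1 - 1) (z - dir κ) ι κ' * stepMatrix κ' κ) =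
      tTerm (N + 1) z := rfl
  rw [ht, Finset.sum_Icc_succ_top (by omega : 1 ≤ N + 1), Nat.sub_self, sum_mul_twoPoint_zero]
  by_cases hz : z ∈ box 2 (N + 1)
  · rw [if_pos hz, kstar_succ, if_pos hz]
    abel
  · rw [if_neg hz, twoPoint_eq_zero_of_not_mem hz, add_zero, tTerm_eq_zero_of_not_mem hz, zero_add]
    symm
    apply Finset.sum_eq_zero
    intro j hj
    apply Finset.sum_eq_zero
    intro y hy
    have hj' := Finset.mem_Icc.1 hj
    have h : z - y ∉ box 2 (N + 1 - j) := fun h => hz (by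
      have h2 := add_mem_box hy h
      have e : j + (N + 1 - j) = N + 1 := by omega
      rwa [add_sub_cancel, e] at h2)
    rw [twoPoint_eq_zero_of_not_mem h, mul_zero]

/-- `K⋆` also has the vanishing `n = 0` slice, i.e. it satisfies the REPAIRED predicate (R1) too. -/
theorem kstar_isTwistedKernel_repaired : kstar 0 = 0 ∧ IsTwistedKernel kstar :=
  ⟨kstar_zero, kstar_isTwistedKernel⟩

/-- **REFUTATION of the crux as typed** (class: misstated; repaired statement: prepend `K 0 = 0 ∧` to the
`IsTwistedKernel` let, or sum from `n = 1`). -/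
theorem twistedGapEquation_false :
    ¬ Summit.CriticalPhenomena.SAWScalingLimit.Theses.SAWTwistedSelfEnergy.TwistedGapEquation :=
  not_crux_of_kernel kstar kstar_isTwistedKernel

/-- **REFUTATION of the support item `TwistedKernelLowOrder` as typed** (same class, same repair). -/
theorem twistedKernelLowOrder_false :
    ¬ Summit.CriticalPhenomena.SAWScalingLimit.Theses.SAWTwistedSelfEnergy.TwistedKernelLowOrder :=
  not_lowOrder_of_kernel kstar kstar_isTwistedKernel

end Summit.CriticalPhenomena.SAWScalingLimit.Cruxes.TwistedGapEquation.Misstatement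

end
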